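import Literature.Analysis.FunctionSpaces.PolchinskiEquation
import Mathlib.Analysis.Calculus.ParametricIntegral
import HarnessLib

/-!
# Time derivative of the renormalised density `e^{−V_t}` under an outer average
# (Bauerschmidt–Bodineau–Dagallier §3.2: the `∂_t e^{−V_t}` part of `−∂_t E_{ν_t} = E_{ν_t} L_t`)

Topic `Literature/Analysis/FunctionSpaces`; sixth "proof architecture" file behind the named fact
`Polchinski.BauerschmidtBodineau_multiscaleBakryEmery` ([BBD] Theorem 3, `MultiscaleBakryEmery.lean`).
The renormalised measure is `E_{ν_t}[F] = e^{V_∞(0)} E_{C_∞−C_t}[e^{−V_t} F]` ([BBD] (e:nut-def),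
`Polchinski.renormExpect`); its `t`-derivative (the dual identity `−∂_t E_{ν_t}F = E_{ν_t}[L_tF]` of
[BBD] Proposition 8) has two parts: the backward heat equation of the fluctuation covariance `C_∞ − C_t`
(`PolchinskiFluctuationHeat.lean`) and the derivative of the integrand `e^{−V_t(ζ)}F(ζ)` in `t` UNDER the
outer average.  This file proves the latter: since `e^{−V_t(y)} = Z_t(y) = E_{C_t}[e^{−V₀(y+w)}]`
([BBD] Def 2) solves the heat equation `∂_t Z_t = ½Δ_{Ċ_t}Z_t` (Prop 5, `hasDerivAt_integral_gaussian`)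
with a derivative bounded uniformly in `y` and locally uniformly in `t`, dominated differentiation gives
`d/dt ∫ e^{−V_t(φ+x)} F(φ+x) dP(x) = ∫ ½(Δ_{Ċ_t}Z_t)(φ+x) F(φ+x) dP(x)` for every finite measure `P`
and bounded measurable `F` ([BBD] proof of Prop 8, p0015: «computing the time derivatives using
Propositions 5 and 7»).

## Main results (sorry-free; no new definitions, no new named facts)

* `abs_half_sum_Cdot_integral_le` — the uniform bound `|½ Σ Ċ_t^{ij} E_{C_t}[∂_i∂_j e^{−V₀}(y+w)]| ≤ ½ Σ_{ij} M_Ċ M`.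
* **`hasDerivAt_integral_exp_neg_renormPotential_mul`** — for `t > 0`, any finite measure `P` on `ℝ^N`,
  `F` bounded measurable:
  `d/dt ∫ e^{−V_t(φ+x)} F(φ+x) dP(x) = ∫ (½ Σ_{ij} Ċ_t^{ij} E_{C_t}[∂_i∂_j e^{−V₀}(φ+x+w)]) F(φ+x) dP(x)`.

Setting: `D : Polchinski.CovDecomposition N` (possibly degenerate `Ċ_t`); `V₀` bounded below with
`e^{−V₀}` twice Fréchet differentiable, `D²e^{−V₀}` bounded and uniformly continuous.
What is NOT here: the combination with the moving fluctuation covariance (the full dual identity),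
Lemma 1, Theorem 3.  Nothing here concerns Yang–Mills.

## References

* [BauerschmidtBodineauDagallier2023] R. Bauerschmidt, T. Bodineau, B. Dagallier, Probab. Surveys 21
  (2024) 200–290, arXiv:2307.07619 — Def 2 p0013, Prop 5 p0014 L24–40, Prop 8 and its proof
  p0014 L77 – p0015 L45. READ (held).
* [BauerschmidtBodineau2021SineGordonLSI] R. Bauerschmidt, T. Bodineau, CPAM 74 (2021), §2. READ (held).
-/

noncomputable section

open MeasureTheory ProbabilityTheory Filter Topology Set
open scoped RealInnerProductSpace Matrix MatrixOrder

namespace Literature.Analysis.FunctionSpaces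

namespace Polchinski

variable {N : ℕ}

section Density

variable (D : CovDecomposition N) {V₀ : EuclideanSpace ℝ (Fin N) → ℝ}
  {D1 : EuclideanSpace ℝ (Fin N) → EuclideanSpace ℝ (Fin N) →L[ℝ] ℝ}
  {D2 : EuclideanSpace ℝ (Fin N) → EuclideanSpace ℝ (Fin N) →L[ℝ] EuclideanSpace ℝ (Fin N) →L[ℝ] ℝ}

/-- Measurability of `x ↦ ∫ G(φ + x + w) dP(w)` for measurable `G`. [folklore] -/
private theorem measurable_integral_shift₃ {G : EuclideanSpace ℝ (Fin N) → ℝ} (hGm : Measurable G)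
    (P : Measure (EuclideanSpace ℝ (Fin N))) [SFinite P] (φ : EuclideanSpace ℝ (Fin N)) :
    Measurable fun x => ∫ w, G (φ + x + w) ∂P := by
  have hsm : StronglyMeasurable
      (Function.uncurry fun (x w : EuclideanSpace ℝ (Fin N)) => G (φ + x + w)) :=
    (hGm.comp ((measurable_const_add φ).comp measurable_fst |>.add measurable_snd)).stronglyMeasurable
  exact (hsm.integral_prod_right (ν := P)).measurable

/-- The matrix elements `y ↦ D²G(y)(e_i,e_j)` are measurable and bounded by `‖D²G‖`. [folklore] -/
private theorem measurable_eval₂_and_bound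
    {M : ℝ} (hM : ∀ x, ‖D2 x‖ ≤ M) (hD2c : Continuous D2) (i j : Fin N) :
    Measurable (fun x => D2 x (EuclideanSpace.single i 1) (EuclideanSpace.single j 1)) ∧
    ∀ x, |D2 x (EuclideanSpace.single i 1) (EuclideanSpace.single j 1)| ≤ M := by
  have hev : Continuous fun L : EuclideanSpace ℝ (Fin N) →L[ℝ] EuclideanSpace ℝ (Fin N) →L[ℝ] ℝ =>
      L (EuclideanSpace.single i 1) (EuclideanSpace.single j 1) :=
    (ContinuousLinearMap.apply ℝ ℝ (EuclideanSpace.single j (1:ℝ))).continuous.comp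
      (ContinuousLinearMap.apply ℝ (EuclideanSpace ℝ (Fin N) →L[ℝ] ℝ)
        (EuclideanSpace.single i (1:ℝ))).continuous
  refine ⟨(hev.comp hD2c).measurable, fun x => ?_⟩
  rw [← Real.norm_eq_abs]
  calc ‖D2 x (EuclideanSpace.single i 1) (EuclideanSpace.single j 1)‖
      ≤ ‖D2 x (EuclideanSpace.single i 1)‖ * ‖EuclideanSpace.single j (1:ℝ)‖ :=
        ContinuousLinearMap.le_opNorm _ _
    _ ≤ ‖D2 x‖ * ‖EuclideanSpace.single i (1:ℝ)‖ * ‖EuclideanSpace.single j (1:ℝ)‖ :=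
        mul_le_mul_of_nonneg_right (ContinuousLinearMap.le_opNorm _ _) (norm_nonneg _)
    _ = ‖D2 x‖ := by simp
    _ ≤ M := hM x

/-- **Uniform bound on `∂_t Z_t(y) = ½ Σ Ċ_t^{ij} E_{C_t}[∂_i∂_j e^{−V₀}(y+w)]`**: if `‖D²e^{−V₀}‖ ≤ M`
and `|Ċ_t^{ij}| ≤ M_Ċ` on `t ≥ 0`, then `|∂_tZ_t(y)| ≤ ½ Σ_{ij} M_Ċ M`, uniformly in `y` and `t ≥ 0`
(the domination needed to differentiate `E[e^{−V_t}F]` in `t`). [cite: BauerschmidtBodineauDagallier2023, Proposition 5 (proof)] -/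
theorem abs_half_sum_Cdot_integral_le {M : ℝ} (hM : ∀ x, ‖D2 x‖ ≤ M) (hD2c : Continuous D2)
    {Mc : ℝ} (hMc : ∀ t, 0 ≤ t → ∀ i j, |D.Cdot t i j| ≤ Mc) {t : ℝ} (ht : 0 ≤ t)
    (y : EuclideanSpace ℝ (Fin N)) :
    |(1 / 2) * ∑ i, ∑ j, D.Cdot t i j *
        ∫ w, D2 (y + w) (EuclideanSpace.single i 1) (EuclideanSpace.single j 1)
          ∂(multivariateGaussian 0 (D.C t))| ≤
      (1 / 2) * ∑ _i : Fin N, ∑ _j : Fin N, Mc * M := by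
  have hM0 : 0 ≤ M := le_trans (norm_nonneg (D2 y)) (hM y)
  have hI : ∀ i j, |∫ w, D2 (y + w) (EuclideanSpace.single i 1) (EuclideanSpace.single j 1)
      ∂(multivariateGaussian 0 (D.C t))| ≤ M := by
    intro i j
    obtain ⟨-, hb⟩ := measurable_eval₂_and_bound hM hD2c i j
    have h := norm_integral_le_of_norm_le_const (μ := multivariateGaussian 0 (D.C t))
      (f := fun w => D2 (y + w) (EuclideanSpace.single i 1) (EuclideanSpace.single j 1)) (C := M)
      (Eventually.of_forall fun w => by rw [Real.norm_eq_abs]; exact hb (y + w))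
    rw [Real.norm_eq_abs, probReal_univ, mul_one] at h
    exact h
  rw [abs_mul, abs_of_pos (by norm_num : (0:ℝ) < 1 / 2)]
  gcongr
  refine (Finset.abs_sum_le_sum_abs _ _).trans (Finset.sum_le_sum fun i _ => ?_)
  refine (Finset.abs_sum_le_sum_abs _ _).trans (Finset.sum_le_sum fun j _ => ?_)
  rw [abs_mul]
  exact mul_le_mul (hMc t ht i j) (hI i j) (abs_nonneg _) ((abs_nonneg _).trans (hMc t ht i j))

/-- **Differentiating the renormalised density under an outer average.**  Let `C_t` be a covariance
decomposition (possibly degenerate `Ċ_t`), `V₀` bounded below with `e^{−V₀}` twice Fréchet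
differentiable, `D²e^{−V₀}` bounded and uniformly continuous, `F` bounded measurable, `P` a finite
measure on `ℝ^N`, `t > 0`.  Then, with `e^{−V_t(y)} = Z_t(y) = E_{C_t}[e^{−V₀(y+w)}]` ([BBD] Def 2) and
`∂_tZ_t = ½Δ_{Ċ_t}Z_t` (Prop 5),
`d/dt ∫ e^{−V_t(φ+x)} F(φ+x) dP(x) = ∫ (½ Σ_{ij} Ċ_t^{ij} E_{C_t}[∂_i∂_j e^{−V₀}(φ+x+w)]) F(φ+x) dP(x)`
(dominated differentiation; the `∂_t e^{−V_t}` contribution to `∂_t E_{ν_t}[F]`, [BBD] proof of Prop 8,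
«computing the time derivatives using Propositions 5 and 7», p0015 L19–21).
[cite: BauerschmidtBodineauDagallier2023, Proposition 8 (proof)] -/
theorem hasDerivAt_integral_exp_neg_renormPotential_mul
    (hG1 : ∀ x, HasFDerivAt (fun x => Real.exp (-V₀ x)) (D1 x) x)
    (hG2 : ∀ x, HasFDerivAt D1 (D2 x) x) {b : ℝ} (hb : ∀ φ, b ≤ V₀ φ)
    {M : ℝ} (hM : ∀ x, ‖D2 x‖ ≤ M) (hUC : UniformContinuous D2)
    {F : EuclideanSpace ℝ (Fin N) → ℝ} (hFm : Measurable F) {KF : ℝ} (hFb : ∀ x, |F x| ≤ KF)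
    (P : Measure (EuclideanSpace ℝ (Fin N))) [IsFiniteMeasure P] {t : ℝ} (ht : 0 < t)
    (φ : EuclideanSpace ℝ (Fin N)) :
    HasDerivAt (fun s => ∫ x, Real.exp (-renormPotential D V₀ s (φ + x)) * F (φ + x) ∂P)
      (∫ x, ((1 / 2) * ∑ i, ∑ j, D.Cdot t i j *
          ∫ w, D2 (φ + x + w) (EuclideanSpace.single i 1) (EuclideanSpace.single j 1)
            ∂(multivariateGaussian 0 (D.C t))) * F (φ + x) ∂P) t := by
  obtain ⟨Mc, hMc⟩ := D.bounded_Cdot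
  have hD2c : Continuous D2 := hUC.continuous
  -- `V₀` is measurable and `|e^{−V₀}| ≤ e^{−b}`
  have hc : Continuous fun x => Real.exp (-V₀ x) :=
    continuous_iff_continuousAt.2 fun x => (hG1 x).continuousAt
  have hV : Measurable V₀ := by
    have he : V₀ = fun x => -Real.log (Real.exp (-V₀ x)) := by
      funext x; rw [Real.log_exp, neg_neg]
    rw [he]
    exact (Real.measurable_log.comp hc.measurable).neg
  have hGb : ∀ x, |Real.exp (-V₀ x)| ≤ Real.exp (-b) := fun x => by
    rw [abs_of_pos (Real.exp_pos _)]
    exact Real.exp_le_exp.2 (neg_le_neg (hb x))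
  -- `e^{−V_s(y)} = E_{C_s}[e^{−V₀(y+ζ)}]`
  have hfun : (fun s => ∫ x, Real.exp (-renormPotential D V₀ s (φ + x)) * F (φ + x) ∂P) =
      fun s => ∫ x, (∫ ζ, Real.exp (-V₀ (φ + x + ζ)) ∂(multivariateGaussian 0 (D.C s))) *
        F (φ + x) ∂P := by
    funext s
    simp_rw [exp_neg_renormPotential D hV hb]
  rw [hfun]
  -- dominated differentiation on the neighbourhood `(t/2, ∞)` of `t`
  have hs : Ioi (t / 2) ∈ 𝓝 t := Ioi_mem_nhds (by linarith)
  have hmeasZ : ∀ s, Measurable fun x =>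
      (∫ ζ, Real.exp (-V₀ (φ + x + ζ)) ∂(multivariateGaussian 0 (D.C s))) * F (φ + x) :=
    fun s => (measurable_integral_shift₃ hc.measurable _ φ).mul (hFm.comp (measurable_const_add φ))
  have hmeasZ' : ∀ s, Measurable fun x => ((1 / 2) * ∑ i, ∑ j, D.Cdot s i j *
      ∫ w, D2 (φ + x + w) (EuclideanSpace.single i 1) (EuclideanSpace.single j 1)
        ∂(multivariateGaussian 0 (D.C s))) * F (φ + x) := by
    intro s
    refine (Measurable.const_mul (Finset.measurable_sum _ fun i _ =>
      Finset.measurable_sum _ fun j _ => Measurable.const_mul ?_ _) _).mul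
      (hFm.comp (measurable_const_add φ))
    obtain ⟨hm, -⟩ := measurable_eval₂_and_bound hM hD2c i j
    exact measurable_integral_shift₃ hm _ φ
  have h := hasDerivAt_integral_of_dominated_loc_of_deriv_le (μ := P) (x₀ := t)
    (F := fun s x => (∫ ζ, Real.exp (-V₀ (φ + x + ζ)) ∂(multivariateGaussian 0 (D.C s))) *
      F (φ + x))
    (F' := fun s x => ((1 / 2) * ∑ i, ∑ j, D.Cdot s i j *
      ∫ w, D2 (φ + x + w) (EuclideanSpace.single i 1) (EuclideanSpace.single j 1)
        ∂(multivariateGaussian 0 (D.C s))) * F (φ + x))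
    (bound := fun _ => ((1 / 2) * ∑ _i : Fin N, ∑ _j : Fin N, Mc * M) * KF) hs
    (Eventually.of_forall fun s => (hmeasZ s).aestronglyMeasurable) ?_
    (hmeasZ' t).aestronglyMeasurable ?_ (integrable_const _) ?_
  · exact h.2
  · -- integrability at `t`: the integrand is bounded by `e^{−b} K_F`
    refine Integrable.of_bound (hmeasZ t).aestronglyMeasurable (Real.exp (-b) * KF)
      (Eventually.of_forall fun x => ?_)
    rw [Real.norm_eq_abs, abs_mul]
    refine mul_le_mul ?_ (hFb _) (abs_nonneg _) (Real.exp_pos _).le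
    rw [abs_of_pos (integral_exp_neg_pos hV hb _ (φ + x))]
    exact integral_exp_neg_le hV hb _ (φ + x)
  · -- domination of the derivative on `(t/2, ∞)`
    refine Eventually.of_forall fun x s hs' => ?_
    have hs0 : 0 ≤ s := by
      have : t / 2 < s := hs'
      linarith
    rw [Real.norm_eq_abs, abs_mul]
    exact mul_le_mul (abs_half_sum_Cdot_integral_le D hM hD2c hMc hs0 (φ + x)) (hFb _)
      (abs_nonneg _) ((abs_nonneg _).trans (abs_half_sum_Cdot_integral_le D hM hD2c hMc hs0 (φ + x)))
  · -- pointwise differentiability: the heat equation for `Z_s(φ + x)` (Prop 5)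
    refine Eventually.of_forall fun x s hs' => ?_
    have hs0 : 0 < s := by
      have : t / 2 < s := hs'
      linarith
    exact (hasDerivAt_integral_gaussian D hG1 hG2 hGb hM hUC hs0 (φ + x)).mul_const _

end Density

end Polchinski

end Literature.Analysis.FunctionSpaces

end
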